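import Summits.NavierStokesRegularity.NavierStokesRegularity.Theorems.CalmPocketDoorExteriorTube
import Summits.NavierStokesRegularity.NavierStokesRegularity.Theorems.CalmPocketDoorPocketPropagation
import Summits.NavierStokesRegularity.NavierStokesRegularity.Theorems.CalmPocketDoorTerminalValue
import Summits.NavierStokesRegularity.NavierStokesRegularity.Theorems.CalmPocketDoorBP32
import HarnessLib

/-!
# CalmPocketDoor — door S32 «CalmPocketDoor» (nsreg-p1 ROUND-30 v2, texts `Theorems/CalmPocketDoorDefs.lean` =
# `r30/Sketch32.lean` v2 d8e333116c9f1838): the UNIT-FRAME CLOSER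

`CalmPocketRegularity` BY NAME (and, in the sequel `…CalmPocketDoor.lean`, `TargetCalmPocket` once PT32 lands), conditional on the Barker–Prange tree fact
`Literature.Analysis.FluidPDE.barkerPrange2021_regular_of_relative_smallness` (BP21 Prop. 10), from the plates
F32 `exteriorTraceTube_holds` (nsreg-C26-p1), Q32 `pocketPropagation_holds` (ns-sfl-p1), I32 `terminalValueIdentification_holds`
(ns-ezl-w2, p632517/p633842), BP32 `bp21CalmShellRegularity_of` (ns-imp-p1) and PT32 `frameTransfer32_holds` (nsreg-C26-p1),
through the compositions `calmPocketRegularity_of` / `targetCalmPocket_of` of the Defs file.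

HONEST FRAME: door S32 is the EXTERIOR door — a regularity CRITERION on hypothetical blow-up profiles (Type II allowed in the
core): a terminally ε-calm exterior velocity pocket excludes the singularity; it is CONDITIONAL on BP21 Prop. 10 as a named
tree fact; item 0056 `NoTypeII` stays OPEN; nothing here bears on NS regularity itself.
-/

noncomputable section

set_option linter.dupNamespace false

namespace Summit.NavierStokesRegularity.NavierStokesRegularity.Theorems.CalmPocketDoor

open MeasureTheory Set Filter Metric Topology
open Literature.Analysis Literature.Analysis.FluidPDE

/-- **DOOR S32 (unit frame) BY NAME, conditional on BP21 Prop. 10**: every datum/exterior level `M` and aperture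
`κ ≤ ½` admit `ε(M,κ) > 0`, `R(M)` such that a terminally `ε`-calm exterior pocket excludes the apex singularity. -/
theorem calmPocketRegularity_holds (h : barkerPrange2021_regular_of_relative_smallness) : CalmPocketRegularity :=
  calmPocketRegularity_of exteriorTraceTube_holds pocketPropagation_holds terminalValueIdentification_holds
    (bp21CalmShellRegularity_of h)

end Summit.NavierStokesRegularity.NavierStokesRegularity.Theorems.CalmPocketDoor

end
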